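import Literature.MathematicalPhysics.QuantumFieldTheory.Balaban1983to89.B9WalkLettersBondLeib
import Literature.MathematicalPhysics.QuantumFieldTheory.Balaban1983to89.B9WalkLettersKernelsDom
import Literature.MathematicalPhysics.QuantumFieldTheory.Balaban1983to89.Node00.OpsYNablaBridge

/-!
# `Balaban1983to89.B9WalkLettersBondDom` — W-b FILE 2: THE BOND-SECTOR LEIBNIZ LETTERS ARE DOMINATED BY THE SITE KERNELS OF RECORD
# (`Identities310₂.hPD ∕ hCD ∕ hPL ∕ hCL ∕ hCLt` of [B9] Theorem 3.10's schema at the coordinate models of `B9WalkLettersBondLeib`, through ONE transfer lemma along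
# node00-def-Y's direction-blind bond map; HOME `pub-ymgap-dag-n06-d/W-b-PLAN.md` §0)

T. Bałaban, *Propagators for lattice gauge theories in a background field*, Commun. Math. Phys. **99** (1985) 389–434 [`Balaban1985BackgroundPropagators`, "B9"];
[4] = T. Bałaban, *Propagators and renormalization transformations for lattice gauge theories. II*, Commun. Math. Phys. **96** (1984) 223–250 [`Balaban1984PropagatorsII`].
statement-level skeleton of published theorems with citation tags; proofs where landed; nothing here is a claim about the Yang–Mills mass gap.

THE PRINT.  p. 391 l. 9 «We have made here the identification A(x, x + ηe_μ) = A_μ(x)»: the vector (bond) sector is the `(d+1)`-fold copy of the scalar (site) sector, so the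
first-order letters of the commutators `[∇_U, h_□]`, `[Δ_U, h_□]`, `[h_□, ∇*_U]` of Theorem 3.10 ((3.100) p. 413, Sect. C p. 414) have THE SAME (3.89)-type sizes as the
site ones ([4] (2.39)–(2.44) pp. 229–230: kernels `≥ 0`, of block range `≤ ρ`, with `O(M⁻¹)` row ∕ column sums).
THE POINT (N06 certificate, dag-n06-d, rows 19; A-side twin of `B9WalkLettersKernelsDom`).  The rows-19 record `𝔬A` is pinned to the bond block map `blkBK bI`
(`hblkA ∕ hblkYA`) with node00-def-Y's bond map of record `bI = bIYOfRecord …`, which is DIRECTION-BLIND (`Node00.OpsYBondMapOfRecord.bIOfRecord_hbI0`: `bI f = bI ⟨f₋, e₀⟩`);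
hence `blkBK bI (b, ν, ·) = blkSK (sIK bI) (chart b₋, ν′, ·)` (def-Y `Node00.OpsYNablaBridge.compat_blkSK_blkBK`), and every bond Leibniz letter is `c_fⁿ • liftBY (site letter)`
(def-Y `Node00.OpsYBondLift`) with `|c_f|·η = 1` at a member (`MemberY.hcfk`).  So the SITE kernels of record `kPDY (= 0) ∕ kCDY ∕ kPLdY ∕ kCLY ∕ kCLtY` (✓`B9WalkLettersKernels`,
keyed by `SblkY x bI □`, radius 3) majorise the bond letters on the bond carrier:
* §1 ★★ `hasMajorant_coordOpK_liftBY` — THE TRANSFER: a block majorant of the site model `coordOpK b (ν ↦ T_ν|_ℝ)` w.r.t. a site block map `blkS` is a block majorant of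
  the bond model `coordOpK b (ν ↦ (lift T_ν)|_ℝ)` w.r.t. any COMPATIBLE bond block map `blkB` (a block-supported bond input of direction `δ` is read through def-Y's
  `dirSliceK δ ν`, same block, same bound); (private) scaling of a majorant;
* §2 the letters as scaled lifts: `cdcoB_eq_smul ∕ cltcoB_eq_smul ∕ plcoB_eq_smul ∕ clcoB_eq_smul` (`c_f •`, `c_f •`, `(−c_f) •`, `(−c_f²) •` of the lifted site letters);
* §3 ★★ `hasMajorant_cdcoB_kCDY`, ★★ `hasMajorant_cltcoB_kCLtY`, ★★ `hasMajorant_plcoB_kPLdY`, ★★ `hasMajorant_clcoB_kCLY` (from ✓`B9WalkLettersKernelsDom.hasMajorant_cdcoS_kCDY ∕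
  _cltcoS_kCLtY ∕ _plcoS_kPLdY ∕ _clcoS_kCLY` by §1–§2 and `|c_f|·η = 1`), `hasMajorantHom_zero_kPDY` (`PD := 0`, `KPD := kPDY = 0`) — the five domination clauses of
  `B9Thm310WholeDir.Identities310₂` at the W-b instance (the record itself is W-b FILE 3).
HONEST SCOPE.  Kernel bookkeeping over landed site dominations ([folklore] transfer + def-Y's dictionary); hypotheses displayed: the 1-faithfulness `hβ1` and direction-blindness
`hbI0` of `bI` (both LAWS of def-Y's `bIOfRecord`), contraction of the bond variables `‖U‖ ≤ 1, ‖U⁻¹‖ ≤ 1` (unitary fibre; the kernels are U-free).  Nothing of [B9]'s estimates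
asserted; COUNT-NEUTRAL; N06 NOT discharged; one finite 𝕋⁴ programme at fixed `ε` — NOT continuum, NOT OS, NOT the mass gap ∕ Clay.  Cell `pub-ymgap` (HUMAN RULING D-0062),
node N06 [B9], seat `pub-ymgap-dag-n06-d` (g31), 2026-08-31.  NEW file.
-/

noncomputable section

namespace Literature.MathematicalPhysics.QuantumFieldTheory.Balaban1983to89.B9WalkLettersBondDom

open Node00
open Node00.OpsYLeibnizLetters (fdiffY lapDiffY fshiftSL pKY cltY)
open Node00.OpsYBondLift (liftBY liftBY_apply liftBY_cutMulY pKBY cltBY)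
open Node00.OpsYNablaBridge (chartY dirSliceK assembleK_dirSliceK blockSupp_dirSliceK compat_blkSK_blkBK abs_cf_mul_etaS_of_hcfk coordOpK_apply4)
open Node00.OpsYSectDCoords (coordOpK_smul)
open B6KLevelCensusIndexV1 (KIdx)
open B6Cover236MultiLevelBlocks (cubes)
open B6RandomWalk (HasMajorant BlockSupp hasMajorant_mono)
open B6RandomWalkHom (HasMajorantHom hasMajorantHom_zero)
open B6Ineq2142KLevelV1 (β)
open B6GlobalChartV1 (PV blkV1)
open B9Eq3104CutoffCommutators (hBdY)
open B9Ineq349SiteComposite (etaS_pos)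
open B9Thm34Ext (toB6)
open B9Thm37CubeCoverCommutators (cutMulY hTY)
open B9PinMembersKLevelV1 (MemberY geo9Y)
open B9CoReadingCoords (XBK coordOpK blkBK)
open B9CoReadingCoordsS (XSK blkSK sIK)
open B9WalkLettersCoordsLeib (plcoS clcoS cdcoS cltcoS)
open B9WalkLettersCoordsDom (hasMajorant_neg')
open B9WalkLettersKernels (kPDY kCDY kPLdY kCLY kCLtY)
open B9WalkLettersKernelsDom (hasMajorant_plcoS_kPLdY hasMajorant_clcoS_kCLY hasMajorant_cdcoS_kCDY hasMajorant_cltcoS_kCLtY)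
open B9WalkLettersBondLeib (cdcoB cltcoB plcoB clcoB)

variable {𝔸 : Type} [NormedRing 𝔸] [NormedAlgebra ℂ 𝔸] [CompleteSpace 𝔸]
variable {κ : Type} [Fintype κ] [DecidableEq κ]
variable {d ℓ : ℕ} {hd : 1 ≤ d + 1} {hL : Odd (ℓ + 1) ∧ 1 < ℓ + 1} {b₀ b₁ : ℝ}

/-! ## §1 The transfer of block majorants from the site carrier to the bond carrier -/

section Transfer

variable (i : KIdx d ℓ hd hL b₀ b₁) (b : Module.Basis κ ℝ 𝔸) {g : B6.Geometry}

omit [DecidableEq κ] [CompleteSpace 𝔸] in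
/-- ★★ **THE TRANSFER**: for COMPATIBLE block maps (`blkS (chart b₋, μ′, ·) = blkB (b, ν, ·)`, def-Y's shape), a block majorant `K` of the site model of a slice family
`T_ν` is a block majorant of the bond model of the lifted family `lift T_ν` — a block-supported bond input `A` of direction `δ` is read through `dirSliceK δ ν A` (same block,
same bound), and `(lift T_ν)(assemble A)(b) = T_ν((assemble A)_δ)(chart b₋)`. [cite: Balaban1985BackgroundPropagators, p.391 l.9, (3.89) p.409; Balaban1984PropagatorsII, (2.51) p.232] -/
theorem hasMajorant_coordOpK_liftBY {blkS : XSK κ i → g.Site} {blkB : XBK κ i → g.Site}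
    (hSB : ∀ (x : Site (PV d ℓ i.m i.K hd hL) 0) (μ μ' ν : Fin (d + 1)) (a c : κ), blkS (chartY i x, μ', a, c) = blkB (⟨x, μ⟩, ν, a, c))
    (T : Fin (d + 1) → Module.End ℂ (SiteY i → 𝔸)) {K : g.Site → g.Site → ℝ}
    (h : HasMajorant (g := g) blkS (coordOpK b (fun ν => (T ν).restrictScalars ℝ)) K) :
    HasMajorant (g := g) blkB (coordOpK b (fun ν => (liftBY i (T ν)).restrictScalars ℝ)) K := by
  intro y' A Bd hA p
  obtain ⟨⟨x, δ⟩, ν, c, c'⟩ := p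
  have e : coordOpK b (fun ν => (liftBY i (T ν)).restrictScalars ℝ) A (⟨x, δ⟩, ν, c, c')
      = coordOpK b (fun ν => (T ν).restrictScalars ℝ) (dirSliceK i δ ν A) (chartY i x, ν, c, c') := by
    rw [coordOpK_apply4, coordOpK_apply4, LinearMap.restrictScalars_apply, LinearMap.restrictScalars_apply, liftBY_apply, assembleK_dirSliceK]
  rw [e, ← hSB x δ ν ν c c']
  exact h y' _ Bd (blockSupp_dirSliceK i hSB hA δ ν) _

omit [Fintype κ] [DecidableEq κ] [CompleteSpace 𝔸] in
/-- scaling a block majorant (verbatim twin of the lineage's private `hasMajorant_smul`). [cite: Balaban1984PropagatorsII, (2.52) p.232, bookkeeping] -/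
private theorem hasMajorant_smul' {X : Type} (blk : X → g.Site) {T : Module.End ℝ (X → ℝ)} {K : g.Site → g.Site → ℝ} (h : HasMajorant (g := g) blk T K) (r : ℝ) :
    HasMajorant (g := g) blk (r • T) (fun a a' => |r| * K a a') := by
  intro y' μ B hμ x
  rw [LinearMap.smul_apply, Pi.smul_apply, smul_eq_mul, abs_mul, mul_assoc]
  exact mul_le_mul_of_nonneg_left (h y' μ B hμ x) (abs_nonneg r)

end Transfer

/-! ## §2 The bond Leibniz models as scaled lifts of the site letters -/

section Letters

variable (i : KIdx d ℓ hd hL b₀ b₁) (b : Module.Basis κ ℝ 𝔸) (B : B9.Backgrounds) (cfg : B.Cfg → CfgY 𝔸 i)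

omit [Fintype κ] [DecidableEq κ] in
/-- a REAL scalar passes through the restriction of scalars. [folklore] -/
private theorem rS_smul_real {V : Type} [AddCommGroup V] [Module ℂ V] (r : ℝ) (A : Module.End ℂ V) :
    ((r : ℂ) • A).restrictScalars ℝ = r • A.restrictScalars ℝ :=
  LinearMap.ext fun v => by
    rw [LinearMap.restrictScalars_apply, LinearMap.smul_apply, LinearMap.smul_apply, LinearMap.restrictScalars_apply, Complex.coe_smul]

omit [Fintype κ] [DecidableEq κ] in
/-- a negated REAL scalar multiple through the restriction of scalars: `(−((r : ℂ) • A))|_ℝ = (−r) • A|_ℝ` (pointwise; avoids the operator-level `neg_smul` instance path). [folklore] -/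
private theorem rS_neg_smul_real {V : Type} [AddCommGroup V] [Module ℂ V] (r : ℝ) (A : Module.End ℂ V) :
    (-((r : ℂ) • A)).restrictScalars ℝ = (-r) • A.restrictScalars ℝ :=
  LinearMap.ext fun v => by
    rw [LinearMap.restrictScalars_apply, LinearMap.neg_apply, LinearMap.smul_apply, LinearMap.smul_apply, LinearMap.restrictScalars_apply, Complex.coe_smul,
      neg_smul]

omit [DecidableEq κ] in
/-- `C^D(U,h) = c_f • (model of the lifted site letter M_{∂⁺_νh}∘S_ν)`. [cite: Balaban1985BackgroundPropagators, (3.100) p.413, p.391 l.9, dictionary] -/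
theorem cdcoB_eq_smul (U₁ : B.Cfg) (h : SiteY i → ℝ) :
    cdcoB i b B cfg U₁ h = i.cf • coordOpK b (fun ν : Fin (d + 1) => (liftBY i (cutMulY (fdiffY i h ν) * fshiftSL i (cfg U₁) ν)).restrictScalars ℝ) := by
  have hν : (fun ν : Fin (d + 1) => (((i.cf : ℝ) : ℂ) • (cutMulY (hBdY i (fdiffY i h ν)) * liftBY i (fshiftSL i (cfg U₁) ν))).restrictScalars ℝ) =
      fun ν => i.cf • (liftBY i (cutMulY (fdiffY i h ν) * fshiftSL i (cfg U₁) ν)).restrictScalars ℝ := by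
    funext ν; rw [map_mul, liftBY_cutMulY, rS_smul_real]
  rw [cdcoB, hν, coordOpK_smul]

omit [DecidableEq κ] in
/-- `C^{Lt}(U,h) = c_f • (model of the lifted site letter C^{Lt}_ν)`. [cite: Balaban1985BackgroundPropagators, (3.100) p.413, p.391 l.9, dictionary] -/
theorem cltcoB_eq_smul (U₁ : B.Cfg) (h : SiteY i → ℝ) :
    cltcoB i b B cfg U₁ h = i.cf • coordOpK b (fun ν : Fin (d + 1) => (liftBY i (cltY i (cfg U₁) h ν)).restrictScalars ℝ) := by
  have hν : (fun ν : Fin (d + 1) => (cltBY i (cfg U₁) h ν).restrictScalars ℝ) = fun ν => i.cf • (liftBY i (cltY i (cfg U₁) h ν)).restrictScalars ℝ := by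
    funext ν; rw [Node00.OpsYBondLift.cltBY, rS_smul_real]
  rw [cltcoB, hν, coordOpK_smul]

omit [DecidableEq κ] in
/-- `P^L_μ(U,h) = (−c_f) • (model of the lifted site letter P_μ)`. [cite: Balaban1985BackgroundPropagators, (3.88) p.409, p.391 l.9, dictionary] -/
theorem plcoB_eq_smul (U₁ : B.Cfg) (h : SiteY i → ℝ) (μ : Fin (d + 1)) :
    plcoB i b B cfg U₁ h μ = (-i.cf) • coordOpK b (fun _ : Fin (d + 1) => (liftBY i (pKY i (cfg U₁) h μ)).restrictScalars ℝ) := by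
  have hν : (fun _ : Fin (d + 1) => (-pKBY i (cfg U₁) h μ).restrictScalars ℝ) = fun _ => (-i.cf) • (liftBY i (pKY i (cfg U₁) h μ)).restrictScalars ℝ := by
    funext ν; rw [Node00.OpsYBondLift.pKBY, rS_neg_smul_real]
  rw [plcoB, hν, coordOpK_smul]

omit [DecidableEq κ] [CompleteSpace 𝔸] in
/-- `C^L(h) = (−c_f²) • (model of the lifted site letter M_{Δh})`. [cite: Balaban1985BackgroundPropagators, (3.88) p.409, (3.100) p.413, p.391 l.9, dictionary] -/
theorem clcoB_eq_smul (h : SiteY i → ℝ) :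
    clcoB (𝔸 := 𝔸) i b h = (-(i.cf ^ 2)) • coordOpK b (fun _ : Fin (d + 1) => (liftBY i (cutMulY (𝔸 := 𝔸) (lapDiffY i h))).restrictScalars ℝ) := by
  have hν : (fun _ : Fin (d + 1) => (-(((i.cf ^ 2 : ℝ) : ℂ) • cutMulY (𝔸 := 𝔸) (hBdY i (lapDiffY i h)))).restrictScalars ℝ) =
      fun _ => (-(i.cf ^ 2)) • (liftBY i (cutMulY (𝔸 := 𝔸) (lapDiffY i h))).restrictScalars ℝ := by
    funext ν; rw [← liftBY_cutMulY, rS_neg_smul_real]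
  rw [clcoB, hν, coordOpK_smul]

end Letters

/-! ## §3 The five dominations of `Identities310₂` at the bond models, by the site kernels of record -/

section Dominations

variable {Mstar : ℕ} (x : MemberY d ℓ hd hL b₀ b₁ Mstar) (b : Module.Basis κ ℝ 𝔸) [FiniteDimensional ℝ 𝔸] (B : B9.Backgrounds)
  (cfg : B.Cfg → CfgY 𝔸 x.toKIdx) {bI : FBondY x.toKIdx → IBondY x.toKIdx} [Fintype (geo9Y x).Site] (R : ℝ) (H : Prop)

omit [DecidableEq κ] [CompleteSpace 𝔸] [FiniteDimensional ℝ 𝔸] [Fintype (geo9Y x).Site] in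
/-- at a member, `|c_f|·η = 1` (print's units `c_f = L^k = η⁻¹`). [cite: Balaban1984PropagatorsII, (2.1) p.224 («η = L^{−k}»), bookkeeping] -/
theorem abs_cf_mul_etaS : |x.toKIdx.cf| * etaS x.toKIdx = 1 := abs_cf_mul_etaS_of_hcfk x.toKIdx x.hcfk

omit [DecidableEq κ] in
/-- ★★ **`Identities310₂.hCD` AT THE W-b INSTANCE**: the `∇`-Leibniz letter `C^D(U,h_□)` of the vector sector (`cdcoB`) has the block majorant `KCD □ := kCDY □` on the bond pin
`blkBK bI`, for contraction-pair bond variables and a direction-blind, 1-faithful `bI`. [cite: Balaban1985BackgroundPropagators, (3.100) p.413, (3.89) p.409; Balaban1984PropagatorsII, (2.39) p.229, (2.51) p.232] -/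
theorem hasMajorant_cdcoB_kCDY
    (hβ1 : ∀ f : FBondY x.toKIdx, (B6Geom246MultiLevelTorus.geomT x.D).dist (β x.hN x.D x.hk (bI f)) (blkV1 x.hN x.D f) ≤ 1)
    (hbI0 : ∀ (z : Site (PV d ℓ x.m x.K hd hL) 0) (μ : Fin (d + 1)), bI ⟨z, μ⟩ = bI ⟨z, 0⟩)
    (c : ↥(cubes x.toKIdx.D.toDomains)) (U₁ : B.Cfg)
    (hU : ∀ (ν : Fin (d + 1)) (w : SiteY x.toKIdx), ‖(UboxY x.toKIdx (cfg U₁) ν w : 𝔸)‖ ≤ 1 ∧ ‖(((UboxY x.toKIdx (cfg U₁) ν w)⁻¹ : 𝔸ˣ) : 𝔸)‖ ≤ 1) :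
    HasMajorant (g := toB6 (geo9Y x) R H) (blkBK x.toKIdx bI) (cdcoB x.toKIdx b B cfg U₁ (hTY x.toKIdx c)) (kCDY x b bI c) := by
  have hη := etaS_pos x.toKIdx
  -- the unscaled site model is `η • cdcoS`, majorant `|η|·KCD`
  have h1 := hasMajorant_smul' _ (hasMajorant_cdcoS_kCDY x b B cfg R H hβ1 c U₁ hU) (etaS x.toKIdx)
  have e1 : etaS x.toKIdx • cdcoS x.toKIdx b B cfg U₁ (hTY x.toKIdx c) =
      coordOpK b (fun ν : Fin (d + 1) => (cutMulY (fdiffY x.toKIdx (hTY x.toKIdx c) ν) * fshiftSL x.toKIdx (cfg U₁) ν).restrictScalars ℝ) := by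
    rw [cdcoS, smul_smul, mul_inv_cancel₀ hη.ne', one_smul]
  rw [e1] at h1
  -- transfer to the bond carrier, then rescale by `c_f`
  have h2 := hasMajorant_smul' _ (hasMajorant_coordOpK_liftBY x.toKIdx b (compat_blkSK_blkBK x.toKIdx hbI0) _ h1) x.toKIdx.cf
  rw [cdcoB_eq_smul]
  refine hasMajorant_mono _ h2 fun a a' => le_of_eq ?_
  rw [← mul_assoc, abs_of_pos hη, abs_cf_mul_etaS x, one_mul]

omit [DecidableEq κ] in
/-- ★★ **`Identities310₂.hCLt` AT THE W-b INSTANCE**: the right `∇*`-Leibniz letter `C^{Lt}(U,h_□)` (`cltcoB`) has the column-type majorant `KCLt □ := kCLtY □` on the bond pin.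
[cite: Balaban1985BackgroundPropagators, (3.100) p.413, (3.8) p.392; Balaban1984PropagatorsII, (2.51) p.232] -/
theorem hasMajorant_cltcoB_kCLtY
    (hβ1 : ∀ f : FBondY x.toKIdx, (B6Geom246MultiLevelTorus.geomT x.D).dist (β x.hN x.D x.hk (bI f)) (blkV1 x.hN x.D f) ≤ 1)
    (hbI0 : ∀ (z : Site (PV d ℓ x.m x.K hd hL) 0) (μ : Fin (d + 1)), bI ⟨z, μ⟩ = bI ⟨z, 0⟩)
    (c : ↥(cubes x.toKIdx.D.toDomains)) (U₁ : B.Cfg)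
    (hU : ∀ (ν : Fin (d + 1)) (w : SiteY x.toKIdx), ‖(UboxY x.toKIdx (cfg U₁) ν w : 𝔸)‖ ≤ 1 ∧ ‖(((UboxY x.toKIdx (cfg U₁) ν w)⁻¹ : 𝔸ˣ) : 𝔸)‖ ≤ 1) :
    HasMajorant (g := toB6 (geo9Y x) R H) (blkBK x.toKIdx bI) (cltcoB x.toKIdx b B cfg U₁ (hTY x.toKIdx c)) (kCLtY x b bI c) := by
  have hη := etaS_pos x.toKIdx
  have h1 := hasMajorant_smul' _ (hasMajorant_cltcoS_kCLtY x b B cfg R H hβ1 c U₁ hU) (etaS x.toKIdx)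
  have e1 : etaS x.toKIdx • cltcoS x.toKIdx b B cfg U₁ (hTY x.toKIdx c) =
      coordOpK b (fun ν : Fin (d + 1) => (cltY x.toKIdx (cfg U₁) (hTY x.toKIdx c) ν).restrictScalars ℝ) := by
    rw [cltcoS, smul_smul, mul_inv_cancel₀ hη.ne', one_smul]
  rw [e1] at h1
  have h2 := hasMajorant_smul' _ (hasMajorant_coordOpK_liftBY x.toKIdx b (compat_blkSK_blkBK x.toKIdx hbI0) _ h1) x.toKIdx.cf
  rw [cltcoB_eq_smul]
  refine hasMajorant_mono _ h2 fun a a' => le_of_eq ?_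
  rw [← mul_assoc, abs_of_pos hη, abs_cf_mul_etaS x, one_mul]

omit [DecidableEq κ] in
/-- ★★ **`Identities310₂.hPL` AT THE W-b INSTANCE**: the Laplacian-Leibniz direction letter `P^L_□,μ` (`plcoB`) has the majorant `KPLd □ μ := kPLdY □ μ` on the bond pin.
[cite: Balaban1985BackgroundPropagators, (3.88) p.409, (3.100) p.413; Balaban1984PropagatorsII, (2.39)–(2.40) pp.229–230, (2.51) p.232] -/
theorem hasMajorant_plcoB_kPLdY
    (hβ1 : ∀ f : FBondY x.toKIdx, (B6Geom246MultiLevelTorus.geomT x.D).dist (β x.hN x.D x.hk (bI f)) (blkV1 x.hN x.D f) ≤ 1)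
    (hbI0 : ∀ (z : Site (PV d ℓ x.m x.K hd hL) 0) (μ : Fin (d + 1)), bI ⟨z, μ⟩ = bI ⟨z, 0⟩)
    (c : ↥(cubes x.toKIdx.D.toDomains)) (μ : Fin (d + 1)) (U₁ : B.Cfg)
    (hU : ∀ w : SiteY x.toKIdx, ‖(UboxY x.toKIdx (cfg U₁) μ w : 𝔸)‖ ≤ 1 ∧ ‖(((UboxY x.toKIdx (cfg U₁) μ w)⁻¹ : 𝔸ˣ) : 𝔸)‖ ≤ 1) :
    HasMajorant (g := toB6 (geo9Y x) R H) (blkBK x.toKIdx bI) (plcoB x.toKIdx b B cfg U₁ (hTY x.toKIdx c) μ) (kPLdY x b bI c μ) := by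
  have hη := etaS_pos x.toKIdx
  -- the unscaled site model is `(−η) • plcoS`, majorant `|−η|·KPLd`
  have h1 := hasMajorant_smul' _ (hasMajorant_plcoS_kPLdY x b B cfg R H hβ1 c μ U₁ hU) (-etaS x.toKIdx)
  have e1 : (-etaS x.toKIdx) • plcoS x.toKIdx b B cfg U₁ (hTY x.toKIdx c) μ =
      coordOpK b (fun _ : Fin (d + 1) => (pKY x.toKIdx (cfg U₁) (hTY x.toKIdx c) μ).restrictScalars ℝ) := by
    rw [plcoS, smul_neg, neg_smul, neg_neg, smul_smul, mul_inv_cancel₀ hη.ne', one_smul]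
  rw [e1] at h1
  have h2 := hasMajorant_smul' _ (hasMajorant_coordOpK_liftBY x.toKIdx b (compat_blkSK_blkBK x.toKIdx hbI0) _ h1) (-x.toKIdx.cf)
  rw [plcoB_eq_smul]
  refine hasMajorant_mono _ h2 fun a a' => le_of_eq ?_
  rw [← mul_assoc, abs_neg, abs_neg, abs_of_pos hη, abs_cf_mul_etaS x, one_mul]

omit [DecidableEq κ] [CompleteSpace 𝔸] [FiniteDimensional ℝ 𝔸] [Fintype (geo9Y x).Site] in
/-- `|c_f²|·η² = 1` at a member (the Laplacian letter's rescaling). [cite: Balaban1984PropagatorsII, (2.1) p.224, bookkeeping] -/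
theorem abs_cf_sq_mul_etaS_sq : |x.toKIdx.cf ^ 2| * etaS x.toKIdx ^ 2 = 1 := by
  rw [abs_pow, ← mul_pow, abs_cf_mul_etaS x, one_pow]

omit [DecidableEq κ] [CompleteSpace 𝔸] in
/-- ★★ **`Identities310₂.hCL` AT THE W-b INSTANCE**: the Laplacian-Leibniz letter `C^L_□ = −c_f²·M_{Δh_□}` (`clcoB`) has the majorant `KCL □ := kCLY □` on the bond pin
(`U`-free letter). [cite: Balaban1985BackgroundPropagators, (3.88) p.409, (3.100) p.413; Balaban1984PropagatorsII, (2.51) p.232] -/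
theorem hasMajorant_clcoB_kCLY
    (hβ1 : ∀ f : FBondY x.toKIdx, (B6Geom246MultiLevelTorus.geomT x.D).dist (β x.hN x.D x.hk (bI f)) (blkV1 x.hN x.D f) ≤ 1)
    (hbI0 : ∀ (z : Site (PV d ℓ x.m x.K hd hL) 0) (μ : Fin (d + 1)), bI ⟨z, μ⟩ = bI ⟨z, 0⟩)
    (c : ↥(cubes x.toKIdx.D.toDomains)) :
    HasMajorant (g := toB6 (geo9Y x) R H) (blkBK x.toKIdx bI) (clcoB (𝔸 := 𝔸) x.toKIdx b (hTY x.toKIdx c)) (kCLY x b bI c) := by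
  have hη := etaS_pos x.toKIdx
  have h1 := hasMajorant_smul' _ (hasMajorant_clcoS_kCLY (𝔸 := 𝔸) x b R H hβ1 c) (-(etaS x.toKIdx ^ 2))
  have e1 : (-(etaS x.toKIdx ^ 2)) • clcoS (𝔸 := 𝔸) x.toKIdx b (hTY x.toKIdx c) =
      coordOpK b (fun _ : Fin (d + 1) => (cutMulY (𝔸 := 𝔸) (lapDiffY x.toKIdx (hTY x.toKIdx c))).restrictScalars ℝ) := by
    rw [clcoS, smul_neg, neg_smul, neg_neg, smul_smul, mul_inv_cancel₀ (pow_ne_zero 2 hη.ne'), one_smul]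
  rw [e1] at h1
  have h2 := hasMajorant_smul' _ (hasMajorant_coordOpK_liftBY x.toKIdx b (compat_blkSK_blkBK x.toKIdx hbI0) _ h1) (-(x.toKIdx.cf ^ 2))
  rw [clcoB_eq_smul]
  refine hasMajorant_mono _ h2 fun a a' => le_of_eq ?_
  rw [← mul_assoc, abs_neg, abs_neg, abs_of_pos (pow_pos hη 2), abs_cf_sq_mul_etaS_sq x, one_mul]

omit [Fintype κ] [DecidableEq κ] [CompleteSpace 𝔸] [FiniteDimensional ℝ 𝔸] in
/-- `Identities310₂.hPD` AT THE W-b INSTANCE: the dead letter `PD := 0` is majorised by `KPD := kPDY = 0`. [cite: Balaban1984PropagatorsII, (2.39) p.229, bookkeeping] -/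
theorem hasMajorantHom_zero_kPDY (c : ↥(cubes x.toKIdx.D.toDomains)) :
    HasMajorantHom (g := toB6 (geo9Y x) R H) (blkBK (κ := κ) x.toKIdx bI) (blkBK (κ := κ) x.toKIdx bI) (0 : Module.End ℝ (XBK κ x.toKIdx → ℝ)) (kPDY x c) :=
  hasMajorantHom_zero _ _

end Dominations

end Literature.MathematicalPhysics.QuantumFieldTheory.Balaban1983to89.B9WalkLettersBondDom

end
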